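import Summits.BirchSwinnertonDyer.Rank1Residual.F1Sign2.GenusTrivialSpinLawWeakAtTwo
import HarnessLib.Audit.Tags
import HarnessLib

/-!
# Cell `bsd-f1-sign2` — descent lens (planner `-desc` g26; MEMO-desc §36, ENGINE 52/53 re-analysis + ENGINE 36/36b, theorem card `MEMO-desc-data/g25/S3-SPIN-LAW.md`): DESC-36 — THE CORRECTED
# `S₃`-SPIN LAW (LAW36, shape form `GenusTrivialTwistCorrectedSpinLawShape`) AND PURE SPIN RECIPROCITY (`PureSpinReciprocityOddClass`); vocabulary `YBitC`, `CorrectionElementC`,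
# `CorrectionParityC`; three kernel glues (sibling of `GenusTrivialSpinLawAtTwo.lean` p731113 / `GenusTrivialSpinLawWeakAtTwo.lean` p732199–p735051, whose §35 carriers it imports)

STATEMENTS + -desc's glue theorems (typer -ty g19).  Source: `HOME/MEMO-desc-data/g26/lean/Sketch36.lean` **8381471299d39706** (137 l.; -desc: farm rc 0, BC7 CLEAN ×2 `bc7_36.txt`
4990ab6a06be9bc5), lines 31–135 VERBATIM (frozen copy in the typer's kit; builder-verified decl by decl).  PORT GATE = REF1-AUDIT §224 (INBOX 2026-08-29T17:37:12Z + ERRATUM 17:37:25Z):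
**DESC-36-T SURVIVES A1–A6 + BC7 and is IN PRINT as a corollary** (R224a: pure prime = Hilbert's primary prime ideal; Hecke Thm. 165 + 171, Lemmermeyer 2007 Thm. 1 —
cites added in the rider; kept `@[conjecture] def` as audited: no Mathlib route), **DESC-36-E SURVIVES `@[conjecture]`** (LAW-candidate, not in print; R224b length bound safe), glue
K224.1–3 = -desc's three theorems below (sorry-free); NO REPAIRS (bodies verbatim).  REF2 v56 (4927bca9b861b6df): T TRUE by Artin reciprocity (KNOWN-IN-SUBSTANCE / VARIANT —
«rest it on cited print, do not spend a prover»); E / LAW36′ NEW-COMBINATION, THEOREM-CANDIDATE at `h_L` odd, `d_q = 1`; (e1) BC5 = unique-fit counts; PREDICTION #22 for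
`d_q = 2` and `q = 2`.  New bib key `Lemmermeyer2007Scholz` (Acta Arith. 129 (2007), arXiv 1310.6599; Thm. 1 verified on held text); `Hecke1981` = GTM 77 (existing key).  BC5 (-desc §36 + REF1 §224 re-tally): DESC-36-T 6 573/6 573 pure primes symmetric on 163 `h_L`-odd runs (C2547-type `h_L` even: 212/761 asymmetric — outside the row);
DESC-36-E explicit `ys` on 162/162 `h_L`-odd runs (`[]` ×104, `[y]` ×46, `[yy′]` ×9, `[y, y′]` ×2, `[y, y′, yy′]` ×1), 0 exceptions; ENGINE 36/36b (kit j333981/j333995, 47 runs,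
1 933 pure primes); ENGINE 37 (j334294): cofactor law 907 938/907 938 cells, parameter-free.  PARTITION none.  Beyond-print theorem: no.
BSD is not proved; 23715 not closed.  bears_on: stmt-BirchSwinnertonDyer-23715.
-/

noncomputable section

open scoped Classical

open WeierstrassCurve Literature.NumberTheory.EllipticCurves Polynomial

namespace Summit.BirchSwinnertonDyer.Rank1Residual.F1Sign2

/-! ### §36 vocabulary -/

/-- THE Y-BIT of a correction element `y ∈ ℤ[X]` (read `y(θ) ∈ ℤ[θ]`) at the prime `𝔭_j` over `p` labelled by `a`: `(y(θ)/𝔭_j) = −1`, i.e. `y(a_j)` is a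
non-square in `ℤ/p` (so in particular `y(a_j) ≠ 0`). -/
def YBitC (y : ℤ[X]) (p : ℕ) (a : Fin 3 → ZMod p) (j : Fin 3) : Prop :=
  ¬ IsSquare (evalModC y p (a j))

/-- A CORRECTION ELEMENT for `W` with cubic datum `c`: `y ∈ ℤ[X]`, `deg y ≤ 2`, `y(θ) ≠ 0`, and `y(θ)` is a unit outside the bad primes of `W`
(every prime factor of `N_{L/ℚ}(y(θ)) = det M_y` divides the conductor `N_W`). -/
def CorrectionElementC (W : WeierstrassCurve ℚ) [W.IsElliptic] (c y : ℤ[X]) : Prop :=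
  y.natDegree ≤ 2 ∧ (mulMatrixCubic c y).det ≠ 0 ∧
    ∀ ℓ : ℕ, ℓ.Prime → (ℓ : ℤ) ∣ (mulMatrixCubic c y).det → ℓ ∣ W.conductorNorm ℤ

/-- The CORRECTION PARITY of the pair `(i, j)` at `p`: the number of correction elements `y ∈ ys` with `(y/𝔭_i) = (y/𝔭_j) = −1` is EVEN.
(`ys = []`: always true.) -/
def CorrectionParityC (ys : List ℤ[X]) (p : ℕ) (a : Fin 3 → ZMod p) (i j : Fin 3) : Prop :=
  Even (ys.countP fun y => decide (YBitC y p a i ∧ YBitC y p a j))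

/-! ### §36 rows -/

/-- **DESC-36-T `PureSpinReciprocityOddClass` (PURE SPIN RECIPROCITY; theorem-candidate, MEMO-desc §36.4).**  Let `c` be a monic irreducible integer cubic with
non-square discriminant (`L = ℚ(θ)` a non-Galois cubic field) and ODD CLASS NUMBER (surrogate `DegOnePrimesOddClassC`).  Let `p ∤ disc c` be totally split,
`(p) = 𝔭₁𝔭₂𝔭₃` labelled by the roots `a`, and PURE: `−1` and every unit of `𝓞_L` are squares modulo each `𝔭_j`.  Then for `i ≠ j` and generators
`g_i(θ), g_j(θ)` of odd powers of `𝔭_i, 𝔭_j`:   `(g_i(θ)/𝔭_j) = (g_j(θ)/𝔭_i)`.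
Proof sketch: purity at `𝔭_i` makes `(𝓞/𝔭_i)^× / im 𝓞^×` of even order, so (class number odd) there is a quadratic `K_i = L(√z_i)` of conductor exactly `𝔭_i`,
`z_i ≡ g_i u_i` mod squares with `u_i` a unit; `z_i, z_j` are unramified classes at every `v ∣ 2∞`, so `Σ_{v∣2∞} (z_i, z_j)_v = 0`; expanding with Hilbert
reciprocity for `(g_i, u_j)`, `(u_i, g_j)`, `(u_i, u_j)` (purity kills `(u/𝔭) `) leaves `(g_i/𝔭_j)(g_j/𝔭_i) = Π_{v∣2∞}(g_i, g_j)_v = 1`.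
For EVEN class number it fails (`z_i ≡ g_i u_i x^{b_i}` with `x ∈ L(∅,2) ∖ units`): C2547 (`h_L = 2`) 13/40 pure primes asymmetric.
BC5 = ENGINE 52 + 53a–f (135 runs, kit j333237 … j333735): `t(p) := ((s₁₂+s₂₁), (s₁₃+s₃₁), (s₂₃+s₃₂)) = 0` at **5 243/5 243** pure primes of the 131 runs with `h_L` odd
(35 of them spin-obstructed curves, where the pure LAW fails at 67–100 % of those same primes), versus 31 417/42 692 `t ≠ 0` at impure primes; `h_L = 2`: 47/60.
Why it might fail: it should not (proof sketch complete at the level of class field theory); as TYPED the surrogate `DegOnePrimesOddClassC` and the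
`ℤ[θ]`-generators (`ℤ[θ] ≠ 𝓞_L` allowed) are the places to check.  Nearest print: the `σ`/`σ⁻¹` joint-spin symmetry of [cite: FIMR2013Spin, §11–12] (cyclic
Galois fields, governed by Hilbert symbols at 2); here non-Galois and conditional on purity.
(Typer -ty g19, REF1-AUDIT §224 (17:37:12Z): **SURVIVES A1–A6 + BC7 — and IS IN PRINT as a corollary (R224a)**: -desc's «pure prime» = Hilbert's «PRIMARY prime
ideal» («`(ε/𝔞) = +1` for all units `ε`»; [cite: Lemmermeyer2007Scholz, Thm. 1, Lemma 1] = Hilbert's First Supplementary Law for odd class number (Hilbert, Furtwängler):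
`𝔞` primary ⟺ `𝔞^h = (α)` with `α` primary ⟺ `L(√α)/L` unramified above `2∞` — verbatim on the held text arXiv 1310.6599 p. 4) and Hecke's reciprocity law for primary
numbers [cite: Hecke1981, Thm. 165, Thm. 171] give `(g_i/𝔭_j) = (α_i/𝔭_j) = (α_i/α_j) = (α_j/α_i) = (g_j/𝔭_i)` in three lines (-desc's ray-class-field sketch above is the
class-field-theoretic proof of Thm. 171); REF2 v56 §1: TRUE — Artin reciprocity for the quadratic ray-class character of conductor `𝔭_i` (`χ_i(Frob_{𝔭_j}) = (g_j/𝔭_i) =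
(g_i/𝔭_j)`); grade KNOWN-IN-SUBSTANCE / VARIANT (FIMR's `σ/σ⁻¹` joint-spin symmetry is the cyclic-Galois shadow).  Kept `@[conjecture] def` AS AUDITED (REF1: no Mathlib route
— no quadratic reciprocity over number fields, no Hecke Gauss sums; REF2: «rest it on the cited print, do not spend a prover»): here the tag marks a Lean OBLIGATION that is a
THEOREM IN PRINT, not an open problem.  BC5 re-tallied by REF1 from the nine raw ENGINE 52/53a–f/36/36b files (`REF1-data/b224/retally224.py`): **6 573/6 573 pure primes
symmetric on the 163 `h_L`-odd runs; 212/761 asymmetric on the 22 `h_L`-even runs; impure primes symmetric only 14 928/56 572** — purity and odd `h` both load-bearing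
(mutations: drop purity ⟹ false; drop odd `h` ⟹ false, C2547-type; drop `i ≠ j` ⟹ trivial; drop the non-square discriminant ⟹ still true); vacuous exactly at `p = 2, 3` and
`p ≡ 3 (mod 4)` (BC7-a/b, intended); generator-independence by `Cl[2] = 0` + purity (A2).  PARTITION: DESC-36-T → IN PRINT (corollary).) -/
@[conjecture] def PureSpinReciprocityOddClass : Prop :=
  ∀ (c : ℤ[X]), c.Monic → c.natDegree = 3 → Irreducible (c.map (Int.castRingHom ℚ)) → ¬ IsSquare (-(Polynomial.resultant c (derivative c))) →
    DegOnePrimesOddClassC c →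
    ∀ (p : ℕ), p.Prime → ¬ ((p : ℤ) ∣ Polynomial.resultant c (derivative c)) →
      ∀ a : Fin 3 → ZMod p, LabelledRootsModC c p a → IntegralUnitsSquareModC c p a →
        ∀ i j : Fin 3, i ≠ j → ∀ (gi gj : ℤ[X]) (oi oj : ℕ),
          GeneratesOddPrimePowerOverC c p (a i) gi oi → GeneratesOddPrimePowerOverC c p (a j) gj oj →
            (IsSquare (evalModC gi p (a j)) ↔ IsSquare (evalModC gj p (a i)))

/-- **DESC-36-E `GenusTrivialTwistCorrectedSpinLawShape` (LAW36, shape form; `@[conjecture]`, beyond print; MEMO-desc §36).**  For every `W` with `Sel₂(W) = 0` whose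
2-division cubic field has ODD class number there is a finite list `ys` of CORRECTION ELEMENTS `y(θ) ∈ ℤ[θ]` — units outside the bad primes, at most three per bad prime —
such that at every pure split prime `p` of every genus-class-trivial twist member (with `p ∤ N(y(θ))`), for all `i ≠ j` and every generator `g` of an odd power of `𝔭_i`
(length bound `3·#{bad primes}`: the correction space `Z_q` at one bad prime has dimension ≤ `dim W(ℚ_q)[2] ≤ 2`, and a HYPERBOLIC plane — observed at `I₄^*`, `c_q = 4` —
costs three rank-one terms `y, y′, yy′`; canonical form: `E_ij = Y_iᵀ Q⁻¹ Y_j` with `Q` the local Tate pairing on `Z = ⊕ Z_q`, MEMO-desc §36.5):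
`Sel₂(W^{(n)}) = 0 ⟺ (m/p) = −1`   iff   ( `(g(a_j)·(e_i − e_j)/p) = +1`  iff  `#{y ∈ ys : (y/𝔭_i) = (y/𝔭_j) = −1}` is even ).
With `ys = []` this is the pure law (DESC-35-S⁺ / S″); the content is that the failure of the pure law is a GRAM PATTERN of Legendre symbols of finitely many FIXED
global elements — hence transposition-symmetric (DESC-36-T), of rank ≤ the number of bad primes, and never «consistent but wrong».  Identification (not part of the
typed row; MEMO-desc §36.2–36.3, REF2 #17): one `y_q` per bad prime `q` at which the conductor `𝔯 = F′(Θ)·𝔇⁻¹` of `ℤ[Θ]` has a prime of odd valuation, `(y_q)·□ =` an odd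
power of the product of those primes; `y_q` generates `Sel₂^{rel q}(W)` and is the «± object at `q`» (nine tested curves have `q = 2`: `I₂, I₆, I₁₀, III^*` at 2 and
2 split with two odd-conductor primes); its cofactor exponent in the Selmer generator `α_i` is `Y_i` itself (reciprocity `Σ_v ⟨α_i, y_q⟩_v = 0`), which is why the
correction is the symmetric product `Y_i Y_j`.  With several obstructing directions the same reciprocity gives LAW36′ (MEMO-desc §36.5):
`E_ij = Σ_q Σ_{(ℓ,s) dual} [(s/𝔭_i) = −1]·[(y_ℓ/𝔭_j) = −1]` over dual bases of the Kummer image `L_q` and of `Sel₂^{rel q}(W)` — entangled (`z = y_q y_q′`),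
independent, and hyperbolic (`c_q = 4`) cases all observed (kit j333981/j333995: 47 runs, 1 933 pure primes, RESULT36.md).
BC5 = ENGINE 52 + 53a–f re-analysed (g26 `an/sixbit.py`, `taufit.py`, `cofactor.py`, `compare36.py`; outputs 4e1cf570f64afd5c, fc2d571b98e99abe, bf4da61de176d9f7): on the 131
runs with `h_L` odd an explicit `ys` exists at ALL 5 243 pure primes — `ys = []` on 96 runs, `ys = [y_q]` on the 35 spin-obstructed runs, `supp y_q =` the odd-`𝔯` primes over
the obstructing `q` on 35/35, flipped sets `F(p) ∈ {∅, {ij, ji}}` 5 290/5 290, cofactor coordinates `w_i ≡ y_q^{Y_i(p)}` exact on every `(p, i)` with a frame; `h_L = 2`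
(C2547) is outside the row and needs a class-group term `b_i X_j` (observed: `Λ = X(x_c)` 40/40).  PREDICTION TESTS running: kit j333981 (cells with two obstructing primes,
additive 2 with odd `𝔯`, `h_L` even) and j333995 (`I₄^*` at 3, REF1 R217a), verdicts pre-registered (PREDICTIONS36.md 03d0a612cfe2fe1c, PREDICTIONS36b.md 4ac2134226366193).
Why it might fail: two obstructing directions at ONE prime (`dim W(ℚ_q)[2] = 2`, e.g. `I₀^*` with `c_q = 4`) may need two elements for one prime (then `ys.length ≤ #bad
primes` is false but the Gram shape survives); and the `x_c`-term shows the odd-class hypothesis is load-bearing.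
[cite: FIMR2013Spin, Thm. 11.1] [cite: KlagsbrunMazurRubin2013, L. 12, 28, 30] [cite: PoonenRains2012, Prop. 4.10] [cite: BrumerKramer1977, §7]
(Typer -ty g19, REF1-AUDIT §224: **SURVIVES `@[conjecture]`** — LAW-candidate, NOT IN PRINT as a statement, fitted post hoc on the obstructed runs (as -desc records above);
A1 rc 0 (`REF1-data/b224/Probe224.lean`: the three glues below = K224.1–3 sorry-free; false-example control rc 1); `∃ ys` BEFORE `∀` members and primes = genuine content, no
junk witness (padding elements with `Y ≡ 0` change nothing; a constant `y = q₀` is a legal rank-one shape, fixed before `p`); `CorrectionParityC` is symmetric in `(i, j)` ⟹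
this row presupposes DESC-36-T, now print (free); **R224b: the length bound `3 · #primeFactors (conductorNorm)` is SAFE** (a symmetric bilinear form on `𝔽₂^m` is a sum of
≤ `m + 1` rank-one forms `λλᵀ`, `m = dim Z ≤ 2ω`; the hyperbolic `I₄^*`, `c₃ = 4` run uses exactly `3 = m + 1`); hidden-hypothesis flag (REF1 (9)(ii)): a correction needed at a
GOOD prime 2 would break the row as typed (support `∣ conductorNorm`) while LAW36′-in-words survives — not observed, first place to look.  BC5 (REF2 v56 (e1): `CorrectionElementC`
admits ANY bad-supported `y` of degree ≤ 2, so the typed row asserts LESS than LAW36′ — the UNIQUE-FIT counts are its evidence): CENSUS36 `h_L`-odd 162 runs — `ys = []` ×104,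
`[y]` ×46, `[y·y′]` ×9 (entangled), `[y, y′]` ×2 (independent: T2n6099i6, T2n8239i10), `[y, y′, yy′]` ×1 (hyperbolic: I4s3hodN14886c4), max length 3; unique fit `supp y_q` =
the odd-𝔯 primes over the obstructing `q` on 35/35 (g25 sample), 8 entangled, 1 hyperbolic; the symmetric-pattern necessary condition independently verified 6 573/6 573 (REF1
§224 (5)); ENGINE 37 (-desc 17:36:54Z, kit j334294, zero fitted parameters): Poonen–Rains structure `dim Sel₂^{rel q} = dim L_q` with non-degenerate pairing at 491/491 bad
primes, cofactor law 907 938/907 938 cells on 158 curves, entangled-vs-independent predicted from descent alone 10/10.  REF2 v56 §5: LAW36′ / DESC-36-E = NEW-COMBINATION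
(Mazur–Rubin 2010 / Klagsbrun–Mazur–Rubin 2013 relaxed-vs-strict Selmer + Brumer–Kramer 1977 + FIMR), THEOREM-CANDIDATE at `h_L` odd and `d_q = 1` modulo the pure-law sketch;
three-root primes (`d_q = 2`, e.g. `I₄^*` with `c_q = 4`, N14886) and `q = 2` share one dimension-4 geometry where no `d = 1`-shaped criterion is exact — REF2 PREDICTION #22
(open; data ask R56b to -desc).  S″ unchanged (SURVIVES).  PARTITION: NOT IN PRINT, conjecture; beyond-print theorem: no.) -/
@[conjecture] def GenusTrivialTwistCorrectedSpinLawShape : Prop :=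
  ∀ (W : WeierstrassCurve ℚ) [W.IsElliptic] [W.IsGloballyMinimal],
    ∀ (c xnum : ℤ[X]) (xden : ℕ), CubicDatumFor W c xnum xden → selmerTwoCard W = 1 → DegOnePrimesOddClassC c →
      ∃ ys : List ℤ[X], (∀ y ∈ ys, CorrectionElementC W c y) ∧ ys.length ≤ 3 * (W.conductorNorm ℤ).primeFactors.card ∧
        ∀ n p : ℕ, GenusTrivialTwistMember W n p → ¬ p ∣ xden → (∀ y ∈ ys, ¬ ((p : ℤ) ∣ (mulMatrixCubic c y).det)) →
          ∀ a : Fin 3 → ZMod p, LabelledRootsModC c p a → Function.Injective (fun j => evalModC xnum p (a j)) →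
            IntegralUnitsSquareModC c p a →
            ∀ i j : Fin 3, i ≠ j → ∀ (g : ℤ[X]) (o : ℕ), GeneratesOddPrimePowerOverC c p (a i) g o →
              (KappaBitOfMember W n p ↔ (SpinBitC xnum xden p a i j g ↔ CorrectionParityC ys p a i j))

/-! ### kernel glue -/

/-- With no correction element the correction parity is trivially even. -/
theorem correctionParityC_nil (p : ℕ) (a : Fin 3 → ZMod p) (i j : Fin 3) : CorrectionParityC [] p a i j := by
  simp [CorrectionParityC]

/-- Kernel glue: LAW36 with the empty list at a curve is literally the pure law there (the `iff` collapses). -/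
theorem kappa_iff_spin_of_shape_nil {W : WeierstrassCurve ℚ} {n p xden : ℕ} {xnum g : ℤ[X]} {a : Fin 3 → ZMod p} {i j : Fin 3}
    (h : KappaBitOfMember W n p ↔ (SpinBitC xnum xden p a i j g ↔ CorrectionParityC [] p a i j)) :
    KappaBitOfMember W n p ↔ SpinBitC xnum xden p a i j g := by
  have h0 : CorrectionParityC [] p a i j := correctionParityC_nil p a i j
  rw [h]; exact ⟨fun h1 => h1.mpr h0, fun h1 => ⟨fun _ => h0, fun _ => h1⟩⟩

/-- Kernel glue: the pure local law DESC-35-S″ supplies LAW36's witness `ys = []` on `SpinSettingLocal` curves (so DESC-36-E restricted to `SpinSettingLocal W c` is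
implied by S″; the new content of DESC-36-E is exactly the spin-obstructed curves). -/
theorem correctedShape_of_local_on_setting (hS : GenusTrivialTwistPureSpinLawLocal)
    (W : WeierstrassCurve ℚ) [W.IsElliptic] [W.IsGloballyMinimal] (c xnum : ℤ[X]) (xden : ℕ)
    (hc : CubicDatumFor W c xnum xden) (hloc : SpinSettingLocal W c) (hodd : DegOnePrimesOddClassC c) :
    ∃ ys : List ℤ[X], (∀ y ∈ ys, CorrectionElementC W c y) ∧ ys.length ≤ 3 * (W.conductorNorm ℤ).primeFactors.card ∧
        ∀ n p : ℕ, GenusTrivialTwistMember W n p → ¬ p ∣ xden → (∀ y ∈ ys, ¬ ((p : ℤ) ∣ (mulMatrixCubic c y).det)) →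
          ∀ a : Fin 3 → ZMod p, LabelledRootsModC c p a → Function.Injective (fun j => evalModC xnum p (a j)) →
            IntegralUnitsSquareModC c p a →
            ∀ i j : Fin 3, i ≠ j → ∀ (g : ℤ[X]) (o : ℕ), GeneratesOddPrimePowerOverC c p (a i) g o →
              (KappaBitOfMember W n p ↔ (SpinBitC xnum xden p a i j g ↔ CorrectionParityC ys p a i j)) := by
  refine ⟨[], by simp, by simp, ?_⟩
  intro n p hm hx _ a ha hinj hpure i j hij g o hg
  have key := hS W c xnum xden hc hloc hodd n p hm hx a ha hinj hpure i j hij g o hg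
  have h0 : CorrectionParityC [] p a i j := correctionParityC_nil p a i j
  constructor
  · intro hk; exact ⟨fun _ => h0, fun _ => key.mp hk⟩
  · intro hs; exact key.mpr (hs.mpr h0)

end Summit.BirchSwinnertonDyer.Rank1Residual.F1Sign2

end
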